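import Literature.Geometry.Kaehler.ChartTorusTransfer
import Mathlib.LinearAlgebra.Multilinear.FiniteDimensional
import Mathlib.Analysis.Calculus.ContDiff.FiniteDimension
import HarnessLib

/-!
# First-order operators on forms read in a chart (Warner 6.32: "the Laplacian induces a partial differential operator `L`")

F. W. Warner, *Foundations of Differentiable Manifolds and Lie Groups*, GTM 94 (1983), 6.32:
"Via this coordinate system, differentiable `p`-forms become vector-valued functions … The
Laplacian `Δ` induces a partial differential operator `L` of order 2 on `C^∞`." We set up the
bookkeeping for the first-order constituents (`d`, `⋆`, type projections and their composites
`∂̄`, `∂̄* = -⋆∂⋆`), whose composites give `L`: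

* `ChartOp1 E F F' k k'` — the chart coefficients of a first-order operator from `F`-valued
  `k`-forms to `F'`-valued `k'`-forms on the model space `E`: a coefficient `B y` of the Fréchet
  derivative of the representative and a coefficient `C y` of its value;
  `Q.applyAt γ y = B y (Dγ(y)) + C y (γ y)`;
* the algebra: `0`, `+`, `-`, scalar multiples, finite sums, zeroth-order operators `ofCLM C`,
  the exterior derivative `extDerivOp` (`B = alternatizeUncurryFinCLM`, `C = 0`), and the two
  compositions `comp₀₁` (zeroth order after first order) and `comp₁₀` (first order after zeroth
  order, product rule `fderiv_clm_apply`), with the smoothness of the coefficients on a set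
  (`ChartOp1.SmoothOn`);
* `ChartOp1.Represents p op Q` — an operator `op` on forms of `M` **is read in the chart at `p`
  by `Q`**: `(op β)̂(y) = Q.applyAt β̂ y` on the chart target for smooth `β`; closure under the
  algebra (`Represents.add`, `.comp₀₁`, `.comp₁₀`, …), the instance `d` (`represents_mextDeriv`,
  from `inChart_mextDeriv_of_mem_target`), zeroth-order operators given pointwise by a constant
  linear map (`represents_of_pointwise`), and **locality** of represented operators
  (`Represents.eq_zero_of_forall`, `Represents.support_subset`).

## References

* F. W. Warner, GTM 94 (1983), 6.32. [WarnerGTM94]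
-/

noncomputable section

open scoped Manifold ContDiff Topology
open Bundle Set Filter Function

-- The coefficient spaces are nested spaces of continuous (multi)linear maps
-- (`(E →L[ℝ] Λ) →L[ℝ] Λ'`); their normed-space instances need nested instance problems.
set_option maxSynthPendingDepth 2
set_option synthInstance.maxHeartbeats 100000

namespace Literature.Geometry.Kaehler

/-! ### Chart coefficients of first-order operators -/

/-- **Chart coefficients of a first-order operator** from `F`-valued `k`-forms to `F'`-valued
`k'`-forms on the model space `E`: `B y` multiplies the Fréchet derivative of the representative,
`C y` its value (Warner 6.32 / 6.24 (2): `L = ∑ a_α D^α`, order `≤ 1`). [cite: WarnerGTM94, 6.32] -/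
structure ChartOp1 (E : Type*) [NormedAddCommGroup E] [NormedSpace ℝ E]
    (F F' : Type*) [NormedAddCommGroup F] [NormedSpace ℝ F] [NormedAddCommGroup F'] [NormedSpace ℝ F']
    (k k' : ℕ) where
  /-- coefficient of the derivative of the representative -/
  B : E → ((E →L[ℝ] (E [⋀^Fin k]→L[ℝ] F)) →L[ℝ] (E [⋀^Fin k']→L[ℝ] F'))
  /-- coefficient of the value of the representative -/
  C : E → ((E [⋀^Fin k]→L[ℝ] F) →L[ℝ] (E [⋀^Fin k']→L[ℝ] F'))

namespace ChartOp1

variable {E : Type*} [NormedAddCommGroup E] [NormedSpace ℝ E]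
  {F F' F'' : Type*} [NormedAddCommGroup F] [NormedSpace ℝ F] [NormedAddCommGroup F'] [NormedSpace ℝ F']
  [NormedAddCommGroup F''] [NormedSpace ℝ F''] {k k' k'' : ℕ}

/-- **The action on representatives**: `Q γ (y) = B y (Dγ(y)) + C y (γ y)`. [cite: WarnerGTM94, 6.32] -/
def applyAt (Q : ChartOp1 E F F' k k') (γ : E → E [⋀^Fin k]→L[ℝ] F) (y : E) : E [⋀^Fin k']→L[ℝ] F' :=
  Q.B y (fderiv ℝ γ y) + Q.C y (γ y)

/-- Unfolding of `applyAt`. [folklore] -/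
theorem applyAt_def (Q : ChartOp1 E F F' k k') (γ : E → E [⋀^Fin k]→L[ℝ] F) (y : E) :
    Q.applyAt γ y = Q.B y (fderiv ℝ γ y) + Q.C y (γ y) := rfl

/-- The zero operator (both coefficients `0`). [folklore] -/
instance : Zero (ChartOp1 E F F' k k') := ⟨⟨fun _ ↦ 0, fun _ ↦ 0⟩⟩
/-- Sum of operators (coefficientwise). [folklore] -/
instance : Add (ChartOp1 E F F' k k') := ⟨fun Q Q' ↦ ⟨fun y ↦ Q.B y + Q'.B y, fun y ↦ Q.C y + Q'.C y⟩⟩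
/-- Negation of an operator (coefficientwise). [folklore] -/
instance : Neg (ChartOp1 E F F' k k') := ⟨fun Q ↦ ⟨fun y ↦ -Q.B y, fun y ↦ -Q.C y⟩⟩
/-- Real scalar multiple of an operator (coefficientwise). [folklore] -/
instance : SMul ℝ (ChartOp1 E F F' k k') := ⟨fun c Q ↦ ⟨fun y ↦ c • Q.B y, fun y ↦ c • Q.C y⟩⟩

/-- Coefficients of `0`. [folklore] -/
@[simp] theorem zero_B (y : E) : (0 : ChartOp1 E F F' k k').B y = 0 := rfl
/-- Coefficients of `0`. [folklore] -/
@[simp] theorem zero_C (y : E) : (0 : ChartOp1 E F F' k k').C y = 0 := rfl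
/-- Coefficients of a sum. [folklore] -/
@[simp] theorem add_B (Q Q' : ChartOp1 E F F' k k') (y : E) : (Q + Q').B y = Q.B y + Q'.B y := rfl
/-- Coefficients of a sum. [folklore] -/
@[simp] theorem add_C (Q Q' : ChartOp1 E F F' k k') (y : E) : (Q + Q').C y = Q.C y + Q'.C y := rfl
/-- Coefficients of a negation. [folklore] -/
@[simp] theorem neg_B (Q : ChartOp1 E F F' k k') (y : E) : (-Q).B y = -Q.B y := rfl
/-- Coefficients of a negation. [folklore] -/
@[simp] theorem neg_C (Q : ChartOp1 E F F' k k') (y : E) : (-Q).C y = -Q.C y := rfl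
/-- Coefficients of a scalar multiple. [folklore] -/
@[simp] theorem smul_B (c : ℝ) (Q : ChartOp1 E F F' k k') (y : E) : (c • Q).B y = c • Q.B y := rfl
/-- Coefficients of a scalar multiple. [folklore] -/
@[simp] theorem smul_C (c : ℝ) (Q : ChartOp1 E F F' k k') (y : E) : (c • Q).C y = c • Q.C y := rfl

/-- `0` acts by `0`. [folklore] -/
@[simp] theorem applyAt_zero (γ : E → E [⋀^Fin k]→L[ℝ] F) (y : E) :
    (0 : ChartOp1 E F F' k k').applyAt γ y = 0 := by simp [applyAt]

/-- Sums act by sums. [folklore] -/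
theorem applyAt_add (Q Q' : ChartOp1 E F F' k k') (γ : E → E [⋀^Fin k]→L[ℝ] F) (y : E) :
    (Q + Q').applyAt γ y = Q.applyAt γ y + Q'.applyAt γ y := by
  simp [applyAt]; abel

/-- Negations act by negations. [folklore] -/
theorem applyAt_neg (Q : ChartOp1 E F F' k k') (γ : E → E [⋀^Fin k]→L[ℝ] F) (y : E) :
    (-Q).applyAt γ y = -Q.applyAt γ y := by
  simp [applyAt]; abel

/-- Scalar multiples act by scalar multiples. [folklore] -/
theorem applyAt_smul (c : ℝ) (Q : ChartOp1 E F F' k k') (γ : E → E [⋀^Fin k]→L[ℝ] F) (y : E) :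
    (c • Q).applyAt γ y = c • Q.applyAt γ y := by
  simp [applyAt, smul_add]

/-- Finite sums of chart operators. [folklore] -/
def finsetSum {ι : Type*} (s : Finset ι) (Q : ι → ChartOp1 E F F' k k') : ChartOp1 E F F' k k' :=
  ⟨fun y ↦ ∑ i ∈ s, (Q i).B y, fun y ↦ ∑ i ∈ s, (Q i).C y⟩

/-- Coefficients of a finite sum. [folklore] -/
@[simp] theorem finsetSum_B {ι : Type*} (s : Finset ι) (Q : ι → ChartOp1 E F F' k k') (y : E) :
    (finsetSum s Q).B y = ∑ i ∈ s, (Q i).B y := rfl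
/-- Coefficients of a finite sum. [folklore] -/
@[simp] theorem finsetSum_C {ι : Type*} (s : Finset ι) (Q : ι → ChartOp1 E F F' k k') (y : E) :
    (finsetSum s Q).C y = ∑ i ∈ s, (Q i).C y := rfl

/-- Finite sums act by finite sums. [folklore] -/
theorem applyAt_finsetSum {ι : Type*} (s : Finset ι) (Q : ι → ChartOp1 E F F' k k')
    (γ : E → E [⋀^Fin k]→L[ℝ] F) (y : E) :
    (finsetSum s Q).applyAt γ y = ∑ i ∈ s, (Q i).applyAt γ y := by
  simp only [applyAt, finsetSum_B, finsetSum_C, FunLike.coe_sum, Finset.sum_apply,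
    Finset.sum_add_distrib]

/-- **Zeroth-order operators**: a field of linear maps acting on the value. [cite: WarnerGTM94, 6.32] -/
def ofCLM (C : E → ((E [⋀^Fin k]→L[ℝ] F) →L[ℝ] (E [⋀^Fin k']→L[ℝ] F'))) : ChartOp1 E F F' k k' :=
  ⟨fun _ ↦ 0, C⟩

/-- Coefficients of a zeroth-order operator. [folklore] -/
@[simp] theorem ofCLM_B (C : E → ((E [⋀^Fin k]→L[ℝ] F) →L[ℝ] (E [⋀^Fin k']→L[ℝ] F'))) (y : E) :
    (ofCLM C).B y = 0 := rfl
/-- Coefficients of a zeroth-order operator. [folklore] -/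
@[simp] theorem ofCLM_C (C : E → ((E [⋀^Fin k]→L[ℝ] F) →L[ℝ] (E [⋀^Fin k']→L[ℝ] F'))) (y : E) :
    (ofCLM C).C y = C y := rfl

/-- Zeroth-order operators act on the value. [folklore] -/
@[simp] theorem applyAt_ofCLM (C : E → ((E [⋀^Fin k]→L[ℝ] F) →L[ℝ] (E [⋀^Fin k']→L[ℝ] F')))
    (γ : E → E [⋀^Fin k]→L[ℝ] F) (y : E) : (ofCLM C).applyAt γ y = C y (γ y) := by
  simp [applyAt]

variable (E F k) in
/-- **The exterior derivative read in a chart**: `B = alternatizeUncurryFin` (constant), `C = 0`,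
so that `applyAt γ = extDeriv γ`. [cite: WarnerGTM94, 6.32] -/
def extDerivOp : ChartOp1 E F F k (k + 1) :=
  ⟨fun _ ↦ ContinuousAlternatingMap.alternatizeUncurryFinCLM ℝ E F, fun _ ↦ 0⟩

/-- The exterior-derivative operator acts by `extDeriv`. [folklore] -/
@[simp] theorem applyAt_extDerivOp (γ : E → E [⋀^Fin k]→L[ℝ] F) (y : E) :
    (extDerivOp E F k).applyAt γ y = extDeriv γ y := by
  simp [applyAt, extDerivOp, extDeriv, ContinuousAlternatingMap.alternatizeUncurryFinCLM_apply]

/-- **Zeroth order after first order**: `(C₁ ∘ Q)`, coefficients `C₁ y ∘ B y`, `C₁ y ∘ C y`.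
[cite: WarnerGTM94, 6.32] -/
def comp₀₁ (C₁ : E → ((E [⋀^Fin k']→L[ℝ] F') →L[ℝ] (E [⋀^Fin k'']→L[ℝ] F''))) (Q : ChartOp1 E F F' k k') :
    ChartOp1 E F F'' k k'' :=
  ⟨fun y ↦ (C₁ y).comp (Q.B y), fun y ↦ (C₁ y).comp (Q.C y)⟩

/-- Coefficients of `comp₀₁`. [folklore] -/
@[simp] theorem comp₀₁_B (C₁ : E → ((E [⋀^Fin k']→L[ℝ] F') →L[ℝ] (E [⋀^Fin k'']→L[ℝ] F'')))
    (Q : ChartOp1 E F F' k k') (y : E) : (comp₀₁ C₁ Q).B y = (C₁ y).comp (Q.B y) := rfl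
/-- Coefficients of `comp₀₁`. [folklore] -/
@[simp] theorem comp₀₁_C (C₁ : E → ((E [⋀^Fin k']→L[ℝ] F') →L[ℝ] (E [⋀^Fin k'']→L[ℝ] F'')))
    (Q : ChartOp1 E F F' k k') (y : E) : (comp₀₁ C₁ Q).C y = (C₁ y).comp (Q.C y) := rfl

/-- `comp₀₁` acts by post-composition. [folklore] -/
theorem applyAt_comp₀₁ (C₁ : E → ((E [⋀^Fin k']→L[ℝ] F') →L[ℝ] (E [⋀^Fin k'']→L[ℝ] F'')))
    (Q : ChartOp1 E F F' k k') (γ : E → E [⋀^Fin k]→L[ℝ] F) (y : E) :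
    (comp₀₁ C₁ Q).applyAt γ y = C₁ y (Q.applyAt γ y) := by
  simp [applyAt]

/-- **First order after zeroth order**: `Q ∘ C₂` by the product rule
`D(C₂ γ)(y) = C₂ y ∘ Dγ(y) + (DC₂(y))^♭ (γ y)`: coefficients `B y ∘ (C₂ y ∘ ·)` and
`C y ∘ C₂ y + B y ∘ (DC₂(y))^♭`. [cite: WarnerGTM94, 6.32] -/
def comp₁₀ (Q : ChartOp1 E F' F'' k' k'') (C₂ : E → ((E [⋀^Fin k]→L[ℝ] F) →L[ℝ] (E [⋀^Fin k']→L[ℝ] F'))) :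
    ChartOp1 E F F'' k k'' :=
  ⟨fun y ↦ (Q.B y).comp (ContinuousLinearMap.compL ℝ E _ _ (C₂ y)),
    fun y ↦ (Q.C y).comp (C₂ y) + (Q.B y).comp (fderiv ℝ C₂ y).flip⟩

/-- Coefficients of `comp₁₀`. [folklore] -/
@[simp] theorem comp₁₀_B (Q : ChartOp1 E F' F'' k' k'')
    (C₂ : E → ((E [⋀^Fin k]→L[ℝ] F) →L[ℝ] (E [⋀^Fin k']→L[ℝ] F'))) (y : E) :
    (comp₁₀ Q C₂).B y = (Q.B y).comp (ContinuousLinearMap.compL ℝ E _ _ (C₂ y)) := rfl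
/-- Coefficients of `comp₁₀`. [folklore] -/
@[simp] theorem comp₁₀_C (Q : ChartOp1 E F' F'' k' k'')
    (C₂ : E → ((E [⋀^Fin k]→L[ℝ] F) →L[ℝ] (E [⋀^Fin k']→L[ℝ] F'))) (y : E) :
    (comp₁₀ Q C₂).C y = (Q.C y).comp (C₂ y) + (Q.B y).comp (fderiv ℝ C₂ y).flip := rfl

/-- **`comp₁₀` acts by pre-composition** (product rule), where `C₂` and `γ` are differentiable.
[folklore] -/
theorem applyAt_comp₁₀ (Q : ChartOp1 E F' F'' k' k'')
    (C₂ : E → ((E [⋀^Fin k]→L[ℝ] F) →L[ℝ] (E [⋀^Fin k']→L[ℝ] F'))) {γ : E → E [⋀^Fin k]→L[ℝ] F} {y : E}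
    (hC : DifferentiableAt ℝ C₂ y) (hγ : DifferentiableAt ℝ γ y) :
    (comp₁₀ Q C₂).applyAt γ y = Q.applyAt (fun y ↦ C₂ y (γ y)) y := by
  simp [applyAt, fderiv_clm_apply hC hγ]
  abel

/-! ### Smoothness of the coefficients -/

/-- Continuous alternating maps between finite-dimensional spaces form a finite-dimensional space
(they embed into multilinear maps). [folklore] -/
theorem finiteDimensional_continuousAlternatingMap [FiniteDimensional ℝ E] [FiniteDimensional ℝ F] :
    FiniteDimensional ℝ (E [⋀^Fin k]→L[ℝ] F) :=
  Module.Finite.of_injective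
    ((ContinuousMultilinearMap.toMultilinearMapLinear (R' := ℝ)).comp
      (ContinuousAlternatingMap.toContinuousMultilinearMapLinear (R := ℝ)))
    (ContinuousMultilinearMap.toMultilinearMap_injective.comp
      ContinuousAlternatingMap.toContinuousMultilinearMap_injective)

/-- The coefficients are `C^∞` on `s`. [folklore] -/
structure SmoothOn (Q : ChartOp1 E F F' k k') (s : Set E) : Prop where
  /-- smoothness of the derivative coefficient -/
  contDiffOn_B : ContDiffOn ℝ ∞ Q.B s
  /-- smoothness of the value coefficient -/
  contDiffOn_C : ContDiffOn ℝ ∞ Q.C s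

/-- `0` has smooth coefficients. [folklore] -/
theorem smoothOn_zero (s : Set E) : (0 : ChartOp1 E F F' k k').SmoothOn s :=
  ⟨contDiffOn_const, contDiffOn_const⟩

/-- Sums of smooth operators are smooth. [folklore] -/
theorem SmoothOn.add {Q Q' : ChartOp1 E F F' k k'} {s : Set E} (hQ : Q.SmoothOn s) (hQ' : Q'.SmoothOn s) :
    (Q + Q').SmoothOn s :=
  ⟨hQ.1.add hQ'.1, hQ.2.add hQ'.2⟩

/-- Negations of smooth operators are smooth. [folklore] -/
theorem SmoothOn.neg {Q : ChartOp1 E F F' k k'} {s : Set E} (hQ : Q.SmoothOn s) : (-Q).SmoothOn s :=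
  ⟨hQ.1.neg, hQ.2.neg⟩

/-- Scalar multiples of smooth operators are smooth. [folklore] -/
theorem SmoothOn.smul (c : ℝ) {Q : ChartOp1 E F F' k k'} {s : Set E} (hQ : Q.SmoothOn s) :
    (c • Q).SmoothOn s :=
  ⟨by
    change ContDiffOn ℝ ∞ (fun y ↦ c • Q.B y) s
    exact hQ.1.const_smul c,
   by
    change ContDiffOn ℝ ∞ (fun y ↦ c • Q.C y) s
    exact hQ.2.const_smul c⟩

/-- Finite sums of smooth operators are smooth. [folklore] -/
theorem SmoothOn.finsetSum {ι : Type*} (s₀ : Finset ι) {Q : ι → ChartOp1 E F F' k k'} {s : Set E}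
    (hQ : ∀ i ∈ s₀, (Q i).SmoothOn s) : (finsetSum s₀ Q).SmoothOn s :=
  ⟨by
    change ContDiffOn ℝ ∞ (fun y ↦ ∑ i ∈ s₀, (Q i).B y) s
    exact ContDiffOn.sum fun i hi ↦ (hQ i hi).1,
   by
    change ContDiffOn ℝ ∞ (fun y ↦ ∑ i ∈ s₀, (Q i).C y) s
    exact ContDiffOn.sum fun i hi ↦ (hQ i hi).2⟩

/-- Zeroth-order operators with smooth coefficient are smooth. [folklore] -/
theorem smoothOn_ofCLM {C : E → ((E [⋀^Fin k]→L[ℝ] F) →L[ℝ] (E [⋀^Fin k']→L[ℝ] F'))} {s : Set E}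
    (hC : ContDiffOn ℝ ∞ C s) : (ofCLM C).SmoothOn s :=
  ⟨contDiffOn_const, hC⟩

/-- The exterior-derivative operator is smooth (constant coefficients). [folklore] -/
theorem smoothOn_extDerivOp (s : Set E) : (extDerivOp E F k).SmoothOn s :=
  ⟨contDiffOn_const, contDiffOn_const⟩

/-- `comp₀₁` of smooth data is smooth. [folklore] -/
theorem SmoothOn.comp₀₁ {C₁ : E → ((E [⋀^Fin k']→L[ℝ] F') →L[ℝ] (E [⋀^Fin k'']→L[ℝ] F''))}
    {Q : ChartOp1 E F F' k k'} {s : Set E} (hC₁ : ContDiffOn ℝ ∞ C₁ s) (hQ : Q.SmoothOn s) :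
    (comp₀₁ C₁ Q).SmoothOn s :=
  ⟨hC₁.clm_comp hQ.1, hC₁.clm_comp hQ.2⟩

/-- `comp₁₀` of smooth data is smooth on an open set (finite-dimensional spaces: smoothness of
the operator-valued coefficients is tested pointwise, `contDiffOn_clm_apply`). [folklore] -/
theorem SmoothOn.comp₁₀ [FiniteDimensional ℝ E] [FiniteDimensional ℝ F] [FiniteDimensional ℝ F']
    {Q : ChartOp1 E F' F'' k' k''}
    {C₂ : E → ((E [⋀^Fin k]→L[ℝ] F) →L[ℝ] (E [⋀^Fin k']→L[ℝ] F'))} {s : Set E} (hs : IsOpen s)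
    (hQ : Q.SmoothOn s) (hC₂ : ContDiffOn ℝ ∞ C₂ s) : (comp₁₀ Q C₂).SmoothOn s := by
  haveI : FiniteDimensional ℝ (E [⋀^Fin k]→L[ℝ] F) := finiteDimensional_continuousAlternatingMap
  haveI : FiniteDimensional ℝ (E [⋀^Fin k']→L[ℝ] F') := finiteDimensional_continuousAlternatingMap
  haveI : FiniteDimensional ℝ (E →L[ℝ] (E [⋀^Fin k]→L[ℝ] F)) := ContinuousLinearMap.finiteDimensional
  have hD : ContDiffOn ℝ ∞ (fderiv ℝ C₂) s := ((contDiffOn_infty_iff_fderiv_of_isOpen hs).1 hC₂).2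
  refine ⟨contDiffOn_clm_apply.2 fun D ↦ ?_, (hQ.2.clm_comp hC₂).add (contDiffOn_clm_apply.2 fun a ↦ ?_)⟩
  · simp only [comp₁₀_B, ContinuousLinearMap.comp_apply, ContinuousLinearMap.compL_apply]
    exact hQ.1.clm_apply (hC₂.clm_comp contDiffOn_const)
  · simp only [ContinuousLinearMap.comp_apply]
    refine hQ.1.clm_apply (contDiffOn_clm_apply.2 fun v ↦ ?_)
    simp only [ContinuousLinearMap.flip_apply]
    exact (hD.clm_apply contDiffOn_const).clm_apply contDiffOn_const

/-- A smooth operator applied to a smooth representative is smooth (on an open set). [folklore] -/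
theorem SmoothOn.contDiffOn_applyAt {Q : ChartOp1 E F F' k k'} {s : Set E} (hs : IsOpen s) (hQ : Q.SmoothOn s)
    {γ : E → E [⋀^Fin k]→L[ℝ] F} (hγ : ContDiffOn ℝ ∞ γ s) : ContDiffOn ℝ ∞ (Q.applyAt γ) s :=
  (hQ.1.clm_apply ((contDiffOn_infty_iff_fderiv_of_isOpen hs).1 hγ).2).add (hQ.2.clm_apply hγ)

end ChartOp1

/-! ### Operators on forms read in a chart -/

section Represents

variable {E : Type*} [NormedAddCommGroup E] [NormedSpace ℝ E]
  {M : Type*} [TopologicalSpace M] [ChartedSpace E M]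
  {F F' F'' : Type*} [NormedAddCommGroup F] [NormedSpace ℝ F] [NormedAddCommGroup F'] [NormedSpace ℝ F']
  [NormedAddCommGroup F''] [NormedSpace ℝ F''] {k k' k'' : ℕ}

/-- **`op` is read in the chart at `p` by `Q`**: for every smooth form `β` and every point `y` of
the chart target, the representative of `op β` at `y` is `Q` applied to the representative of
`β` (Warner 6.32: the operator "induced on Euclidean space via a coordinate system").
[cite: WarnerGTM94, 6.32] -/
structure ChartOp1.Represents (p : M) (op : MForm 𝓘(ℝ, E) M F k → MForm 𝓘(ℝ, E) M F' k')
    (Q : ChartOp1 E F F' k k') : Prop where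
  /-- the chart formula -/
  inChart_eq : ∀ ⦃β : MForm 𝓘(ℝ, E) M F k⦄, IsSmoothForm β → ∀ ⦃y : E⦄,
    y ∈ (extChartAt 𝓘(ℝ, E) p).target → (op β).inChart p y = Q.applyAt (β.inChart p) y

namespace ChartOp1.Represents

variable {p : M}

/-- The zero operator is read by `0`. [folklore] -/
theorem zero : ChartOp1.Represents p (fun _ : MForm 𝓘(ℝ, E) M F k ↦ (0 : MForm 𝓘(ℝ, E) M F' k'))
    (0 : ChartOp1 E F F' k k') :=
  ⟨fun β _ y _ ↦ by rw [MForm.inChart_zero, ChartOp1.applyAt_zero]; rfl⟩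

/-- Sums of represented operators. [folklore] -/
theorem add {op op' : MForm 𝓘(ℝ, E) M F k → MForm 𝓘(ℝ, E) M F' k'} {Q Q' : ChartOp1 E F F' k k'}
    (h : Represents p op Q) (h' : Represents p op' Q') :
    Represents p (fun β ↦ op β + op' β) (Q + Q') :=
  ⟨fun β hβ y hy ↦ by
    rw [MForm.inChart_add, ChartOp1.applyAt_add, Pi.add_apply, h.inChart_eq hβ hy, h'.inChart_eq hβ hy]⟩

/-- Negations of represented operators. [folklore] -/
theorem neg {op : MForm 𝓘(ℝ, E) M F k → MForm 𝓘(ℝ, E) M F' k'} {Q : ChartOp1 E F F' k k'}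
    (h : Represents p op Q) : Represents p (fun β ↦ -op β) (-Q) :=
  ⟨fun β hβ y hy ↦ by
    rw [ChartOp1.applyAt_neg, ← h.inChart_eq hβ hy, ← neg_one_smul ℝ (op β), MForm.inChart_smul,
      Pi.smul_apply, neg_one_smul]⟩

/-- Real scalar multiples of represented operators. [folklore] -/
theorem smul (c : ℝ) {op : MForm 𝓘(ℝ, E) M F k → MForm 𝓘(ℝ, E) M F' k'} {Q : ChartOp1 E F F' k k'}
    (h : Represents p op Q) : Represents p (fun β ↦ c • op β) (c • Q) :=
  ⟨fun β hβ y hy ↦ by rw [MForm.inChart_smul, ChartOp1.applyAt_smul, Pi.smul_apply, h.inChart_eq hβ hy]⟩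

/-- Finite sums of represented operators. [folklore] -/
theorem finsetSum {ι : Type*} (s : Finset ι) {op : ι → MForm 𝓘(ℝ, E) M F k → MForm 𝓘(ℝ, E) M F' k'}
    {Q : ι → ChartOp1 E F F' k k'} (h : ∀ i ∈ s, Represents p (op i) (Q i)) :
    Represents p (fun β ↦ ∑ i ∈ s, op i β) (ChartOp1.finsetSum s Q) := by
  classical
  induction s using Finset.induction_on with
  | empty =>
    refine ⟨fun β hβ y hy ↦ ?_⟩
    simp only [Finset.sum_empty, ChartOp1.applyAt_finsetSum]
    rw [MForm.inChart_zero]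
    rfl
  | insert i s hi ih =>
    refine ⟨fun β hβ y hy ↦ ?_⟩
    have h1 := (h i (Finset.mem_insert_self i s)).inChart_eq hβ hy
    have h2 := (ih fun j hj ↦ h j (Finset.mem_insert_of_mem hj)).inChart_eq hβ hy
    simp only [ChartOp1.applyAt_finsetSum] at h2 ⊢
    rw [Finset.sum_insert hi, Finset.sum_insert hi, MForm.inChart_add, Pi.add_apply, h1, h2]

/-- **Zeroth order after first order**: if `op₁` is read by the field `C₁` (no derivative) and
`op` by `Q`, and `op` preserves smoothness, then `op₁ ∘ op` is read by `comp₀₁ C₁ Q`. [folklore] -/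
theorem comp₀₁ {op₁ : MForm 𝓘(ℝ, E) M F' k' → MForm 𝓘(ℝ, E) M F'' k''}
    {C₁ : E → ((E [⋀^Fin k']→L[ℝ] F') →L[ℝ] (E [⋀^Fin k'']→L[ℝ] F''))}
    (h₁ : Represents p op₁ (ChartOp1.ofCLM C₁)) {op : MForm 𝓘(ℝ, E) M F k → MForm 𝓘(ℝ, E) M F' k'}
    {Q : ChartOp1 E F F' k k'} (h : Represents p op Q) (hop : ∀ β, IsSmoothForm β → IsSmoothForm (op β)) :
    Represents p (fun β ↦ op₁ (op β)) (ChartOp1.comp₀₁ C₁ Q) :=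
  ⟨fun β hβ y hy ↦ by
    rw [h₁.inChart_eq (hop β hβ) hy, ChartOp1.applyAt_ofCLM, h.inChart_eq hβ hy, ChartOp1.applyAt_comp₀₁]⟩

variable [IsManifold 𝓘(ℝ, E) ∞ M]

/-- **First order after zeroth order**: if `op₂` is read by the field `C₂`, smooth on the target,
`op` by `Q`, and `op₂` preserves smoothness, then `op ∘ op₂` is read by `comp₁₀ Q C₂`
(product rule). [folklore] -/
theorem comp₁₀ {op : MForm 𝓘(ℝ, E) M F' k' → MForm 𝓘(ℝ, E) M F'' k''} {Q : ChartOp1 E F' F'' k' k''}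
    (h : Represents p op Q) {op₂ : MForm 𝓘(ℝ, E) M F k → MForm 𝓘(ℝ, E) M F' k'}
    {C₂ : E → ((E [⋀^Fin k]→L[ℝ] F) →L[ℝ] (E [⋀^Fin k']→L[ℝ] F'))}
    (h₂ : Represents p op₂ (ChartOp1.ofCLM C₂)) (hC₂ : ContDiffOn ℝ ∞ C₂ (extChartAt 𝓘(ℝ, E) p).target)
    (hop₂ : ∀ β, IsSmoothForm β → IsSmoothForm (op₂ β)) :
    Represents p (fun β ↦ op (op₂ β)) (ChartOp1.comp₁₀ Q C₂) :=
  ⟨fun β hβ y hy ↦ by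
    have hd : DifferentiableAt ℝ C₂ y :=
      (hC₂.contDiffAt ((isOpen_extChartAt_target p).mem_nhds hy)).differentiableAt (by simp)
    have hγ : DifferentiableAt ℝ (β.inChart p) y :=
      ((hβ.contDiffOn_inChart_target p).contDiffAt
        ((isOpen_extChartAt_target p).mem_nhds hy)).differentiableAt (by simp)
    -- the representative of `op₂ β` agrees with `C₂ · β̂` near `y`
    have hev : (op₂ β).inChart p =ᶠ[𝓝 y] fun y ↦ C₂ y (β.inChart p y) := by
      filter_upwards [(isOpen_extChartAt_target p).mem_nhds hy] with y' hy'
      rw [h₂.inChart_eq hβ hy', ChartOp1.applyAt_ofCLM]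
    rw [h.inChart_eq (hop₂ β hβ) hy, ChartOp1.applyAt_comp₁₀ Q C₂ hd hγ, ChartOp1.applyAt_def,
      ChartOp1.applyAt_def, hev.fderiv_eq, hev.self_of_nhds]⟩

/-- **Zeroth-order operators given pointwise by a constant linear map commuting with the tangent
coordinate changes** are read by that constant map: if `(op β) x = L ∘ (β x)` pointwise with
`L a = a ∘ ?`-free, i.e. `L` acts only on the values (`L (a.compContinuousLinearMap φ) =
(L a).compContinuousLinearMap φ` for all coordinate changes `φ`), then `op` is read by
`ofCLM (fun _ ↦ L)`. [folklore] -/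
theorem of_pointwise {op : MForm 𝓘(ℝ, E) M F k → MForm 𝓘(ℝ, E) M F' k}
    (L : (E [⋀^Fin k]→L[ℝ] F) →L[ℝ] (E [⋀^Fin k]→L[ℝ] F'))
    (hL : ∀ (a : E [⋀^Fin k]→L[ℝ] F) (φ : E →L[ℝ] E),
      L (a.compContinuousLinearMap φ) = (L a).compContinuousLinearMap φ)
    (hop : ∀ (β : MForm 𝓘(ℝ, E) M F k) (x : M), op β x = L (β x)) :
    Represents p op (ChartOp1.ofCLM fun _ ↦ L) :=
  ⟨fun β _ y hy ↦ by
    rw [ChartOp1.applyAt_ofCLM, MForm.inChart_eq_of_mem_target _ hy, MForm.inChart_eq_of_mem_target _ hy,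
      hop]
    exact (hL _ _).symm⟩

/-- **`d` is read by the exterior-derivative operator** (`(dα)̂ = d α̂` on the target,
`inChart_mextDeriv_of_mem_target`). [cite: WarnerGTM94, Prop. 2.23] -/
theorem mextDeriv : Represents p (mextDeriv : MForm 𝓘(ℝ, E) M F k → MForm 𝓘(ℝ, E) M F (k + 1))
    (ChartOp1.extDerivOp E F k) :=
  ⟨fun β hβ y hy ↦ by
    rw [ChartOp1.applyAt_extDerivOp, inChart_mextDeriv_of_mem_target β hy
      ((isSmoothForm_iff_smoothAt β).1 hβ _), ModelWithCorners.Boundaryless.range_eq_univ, extDerivWithin_univ]⟩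

/-! #### Locality of represented operators -/

/-- **A represented operator is local at the chart point**: if `β` is smooth and vanishes near
`p`, then `op β` vanishes at `p`. [folklore] -/
theorem apply_eq_zero {op : MForm 𝓘(ℝ, E) M F k → MForm 𝓘(ℝ, E) M F' k'} {Q : ChartOp1 E F F' k k'}
    (h : Represents p op Q) {β : MForm 𝓘(ℝ, E) M F k} (hβ : IsSmoothForm β)
    (h0 : ∀ᶠ x in 𝓝 p, β x = 0) : op β p = 0 := by
  have hy : extChartAt 𝓘(ℝ, E) p p ∈ (extChartAt 𝓘(ℝ, E) p).target := mem_extChartAt_target p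
  -- the representative of `β` vanishes near the chart point
  have hev : β.inChart p =ᶠ[𝓝 (extChartAt 𝓘(ℝ, E) p p)] fun _ ↦ 0 := by
    have h1 : ∀ᶠ y in 𝓝 (extChartAt 𝓘(ℝ, E) p p), y ∈ (extChartAt 𝓘(ℝ, E) p).target :=
      (isOpen_extChartAt_target p).mem_nhds hy
    have h2 : ∀ᶠ y in 𝓝 (extChartAt 𝓘(ℝ, E) p p), β ((extChartAt 𝓘(ℝ, E) p).symm y) = 0 := by
      have hc : ContinuousAt (extChartAt 𝓘(ℝ, E) p).symm (extChartAt 𝓘(ℝ, E) p p) :=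
        continuousAt_extChartAt_symm p
      have h0' : ∀ᶠ x in 𝓝 ((extChartAt 𝓘(ℝ, E) p).symm (extChartAt 𝓘(ℝ, E) p p)), β x = 0 := by
        rwa [extChartAt_to_inv]
      exact hc.eventually h0'
    filter_upwards [h1, h2] with y hy1 hy2
    exact MForm.inChart_eq_zero_of_apply_eq_zero hy1 hy2
  have hrep : (op β).inChart p (extChartAt 𝓘(ℝ, E) p p) = 0 := by
    rw [h.inChart_eq hβ hy, ChartOp1.applyAt, hev.fderiv_eq, hev.self_of_nhds]
    simp
  have := MForm.apply_symm_eq_of_inChart_eq (α := op β) (β := (0 : MForm 𝓘(ℝ, E) M F' k')) hy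
    (by rw [hrep, MForm.inChart_zero]; rfl)
  rwa [extChartAt_to_inv] at this

end ChartOp1.Represents

variable [IsManifold 𝓘(ℝ, E) ∞ M]

/-- **Locality**: an operator read in the chart at every point kills, on an open set, every smooth
form vanishing there. [folklore] -/
theorem ChartOp1.Represents.eq_zero_of_forall {op : MForm 𝓘(ℝ, E) M F k → MForm 𝓘(ℝ, E) M F' k'}
    {Q : M → ChartOp1 E F F' k k'} (h : ∀ p, ChartOp1.Represents p op (Q p))
    {β : MForm 𝓘(ℝ, E) M F k} (hβ : IsSmoothForm β) {U : Set M} (hU : IsOpen U) (h0 : ∀ x ∈ U, β x = 0)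
    {x : M} (hx : x ∈ U) : op β x = 0 :=
  (h x).apply_eq_zero hβ (Filter.eventually_of_mem (hU.mem_nhds hx) h0)

variable [T2Space M] in
/-- **Represented operators preserve chart supports**: if `β` is smooth and vanishes off the
chart preimage of a compact `K` inside the target of the chart at `p`, so does `op β`. [folklore] -/
theorem ChartOp1.Represents.support_subset {op : MForm 𝓘(ℝ, E) M F k → MForm 𝓘(ℝ, E) M F' k'}
    {Q : M → ChartOp1 E F F' k k'} (h : ∀ p, ChartOp1.Represents p op (Q p)) {p : M}
    {β : MForm 𝓘(ℝ, E) M F k} (hβ : IsSmoothForm β) {K : Set E} (hKc : IsCompact K)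
    (hKt : K ⊆ (extChartAt 𝓘(ℝ, E) p).target)
    (hK : ∀ x, β x ≠ 0 → x ∈ (extChartAt 𝓘(ℝ, E) p).source ∧ extChartAt 𝓘(ℝ, E) p x ∈ K)
    (x : M) (hx : op β x ≠ 0) :
    x ∈ (extChartAt 𝓘(ℝ, E) p).source ∧ extChartAt 𝓘(ℝ, E) p x ∈ K := by
  -- `β` vanishes on the open complement of the compact chart copy of `K`
  set Z := (extChartAt 𝓘(ℝ, E) p).symm '' K with hZ
  have hZc : IsCompact Z := hKc.image_of_continuousOn ((continuousOn_extChartAt_symm p).mono hKt)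
  have hβ0 : ∀ x ∈ Zᶜ, β x = 0 := fun x hx' ↦ by
    by_contra hne
    obtain ⟨hs, hk⟩ := hK x hne
    exact hx' ⟨_, hk, (extChartAt 𝓘(ℝ, E) p).left_inv hs⟩
  have hxZ : x ∈ Z := by
    by_contra hxZ
    exact hx (ChartOp1.Represents.eq_zero_of_forall h hβ hZc.isClosed.isOpen_compl hβ0 hxZ)
  obtain ⟨y, hy, rfl⟩ := hxZ
  exact ⟨(extChartAt 𝓘(ℝ, E) p).map_target (hKt hy), by rwa [(extChartAt 𝓘(ℝ, E) p).right_inv (hKt hy)]⟩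

end Represents

end Literature.Geometry.Kaehler
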